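import Summits.QuantumAdvantage.QuantumAdvantage.Theses.CentralFactorial
import Literature.Computability.Complexity.CircuitLowerBoundsIW

/-!
# Line `birth` — BC3 skeleton for the crux `WilsonThesis` (stmt-QuantumAdvantage-10304)

Route `CentralFactorial` (route-QuantumAdvantage-CentralFactorial; `closes (h₁ : MatthewsQuarticSign)
(h₂ : WilsonMemBQPOfMatthews) (h₃ : WilsonThesis) : QuantumAdvantage`), crux rank 0 (the route's X, auto-crux):

  `WilsonThesis := L_W ∉ BPP`,
  `L_W := Computability.encodingNatBool.toLanguage {p : ℕ | p.Prime ∧ p % 4 = 1 ∧ 2 * (((p - 1) / 2)! % p) < p}`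

— the CENTRAL-FACTORIAL language (the Wilson bit: which square root of `−1 (mod p)` the number `((p−1)/2)! mod p`
is) has no bounded-error probabilistic polynomial-time decider.  A classical LOWER BOUND (hypothesis-type: it implies
`P ≠ PSPACE`, since `L_W ∈ PSPACE`); its negation `WilsonClassical` is the route's filed kill.

THE LINE (derandomization seam; k = 2; glue = the tree's PROVED Impagliazzo–Wigderson theorem):

  stub_eHardAE     some language in `E = DTIME(2^{O(n)})` needs circuits of size `2^{εn}` at all large `n`
                   (the Impagliazzo–Wigderson hypothesis — verbatim the antecedent of the Literature named fact
                   `Literature.Computability.Complexity.impagliazzo_wigderson`, pnp.S24);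
  stub_wilsonNotP  `L_W ∉ P` — no DETERMINISTIC polynomial-time decider for the Wilson bit (the arithmetic content:
                   today `((p−1)/2)! mod p` costs `p^{1/2+o(1)}` (Strassen; Bostan–Gaudry–Schost 2007), or — via the
                   Chowla/Kiselev sign law — a regulator-plus-class-number computation in `ℚ(√p)`, `p^{1/4+o(1)}`
                   deterministically; a polylog deterministic evaluation would refute this stub outright);
  ───────────────────────────────────────────────────────────────────────────────────────────────────────────
  compose          `stub_eHardAE-sig → stub_wilsonNotP-sig → L_W ∉ BPP` (sorry-free, closed: Impagliazzo–Wigderson 1997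
                   Thm 2, `impagliazzo_wigderson_holds : … → P = BPP`, Literature/Computability/Complexity/CircuitLowerBoundsIW.lean,
                   then rewrite `BPP` to `P`);
  WilsonThesis_of  `: WilsonThesis := compose stub_eHardAE stub_wilsonNotP` — the ONLY theorem of this file whose head is the
                   crux BY NAME (`WilsonThesis` unfolds to `compose`'s conclusion by `Iff.rfl`, `wilsonThesis_iff`).

Which way the pieces sit (proved in the registrar's folder, bc/WilsonThesis_honesty.lean, rc 0, closed; attached as
evidence on the item — kept out of this file so that it has no orphan declarations): `WilsonThesis → L_W ∉ P` (stub 2 is a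
CONSEQUENCE of the crux, by the tree theorem `P_subset_BPP_holds`), and `stub_eHardAE-sig → (WilsonThesis ↔ L_W ∉ P)`
(stub 1 is exactly what converts the crux into stub 2; `P = BPP` is open, so neither stub is the crux — BC3 probes
`stub → WilsonThesis`, `stub → QuantumAdvantage` by `first | exact? | simpa | (unfold; simpa) | aesop` FAIL 4/4,
folder bc/stub_*_probe.lean, quoted in Lines/birth.md).

Jointly the two stubs are NOT summit-strength (they give `L_W ∉ BPP` only; `QuantumAdvantage` still needs the route's
theorem-targets `MatthewsQuarticSign → WilsonMemBQPOfMatthews`, i.e. `L_W ∈ BQP`).  Separately: `stub_eHardAE` mentions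
neither `L_W` nor `BPP`'s witness languages; `stub_wilsonNotP` says nothing about randomness.

Same seam as the sibling crux skeleton `Cruxes/YbTarget/Lines/derandomization_split.lean` (stub `stub_eHard` there has the
identical signature; it is also the route item `YangBaxterIslands.YbEHard`, stmt-QuantumAdvantage-17622) — one programme-wide
hypothesis, stated verbatim so that a single discharge / refutation serves every line using it.

Disproof used: none exists for this crux (`ledger crux ls stmt-QuantumAdvantage-10304`: no workfiles before this one — no
`Disproof.lean`, no landed `Theorems/WilsonThesis/Negative/*`); `ledger negatives --problem QuantumAdvantage` (6 entries) has
nothing on factorials, derandomization or `E`.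

`sorry` occurs ONLY in the two `stub_*` theorems.
-/

-- `Summit.<Summit>.<Problem>`: for the single-conjunct summit the duplicate `QuantumAdvantage.QuantumAdvantage` is mandated.
set_option linter.dupNamespace false

namespace Summit.QuantumAdvantage.QuantumAdvantage.Cruxes.WilsonThesis.Birth

open Summit.QuantumAdvantage.QuantumAdvantage.Theses.CentralFactorial

/-! ## The two registered stubs (signatures fully qualified; registered verbatim) -/

/-- **Stub 1 — `E` requires exponential circuits almost everywhere** (the Impagliazzo–Wigderson hypothesis;
hypothesis-type, programme-wide).  Some language decidable in time `2^{O(n)}` has circuit complexity at least `2^{εn}`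
for all large `n`.  Verbatim the antecedent of the named fact `Literature.Computability.Complexity.impagliazzo_wigderson`
(pnp.S24), whose conclusion `P = BPP` the tree PROVES from it (`impagliazzo_wigderson_holds`).  Why plausibly true: the
standard assumption of hardness-vs-randomness (ImpagliazzoWigderson1997 Thm 2; NisanWigderson1994 Thm 3; AroraBarak2009
Thm 20.7: "the reasonable assumption"); its failure means `E ⊆ ⋂_ε i.o.-SIZE(2^{εn})`.  Why it might fail / never be
proved here: an exponential circuit lower bound for an explicit function (open since Shannon's counting argument;
natural-proofs, relativization and algebrization barriers all bear on it).  Never staffed for proof.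
Leans on: `Literature.Computability.Complexity.E`, `Language.circuitSize` (CircuitClasses.lean).
Sources: ImpagliazzoWigderson1997, NisanWigderson1994, AroraBarak2009 §20. -/
theorem stub_eHardAE :
    ∃ L ∈ Literature.Computability.Complexity.E, ∃ ε : ℝ, 0 < ε ∧
      ∀ᶠ n : ℕ in Filter.atTop, (2 : ℝ) ^ (ε * n) ≤ (L.circuitSize n : ℝ) := by
  sorry

/-- **Stub 2 — the Wilson bit is not in `P`** (LOAD-BEARING for this route; the arithmetic content).  The
central-factorial language `L_W = {p prime ≡ 1 (4) : 2·(((p−1)/2)! mod p) < p}` (natural-number code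
`Computability.encodingNatBool`) has no deterministic polynomial-time decider.  Why plausibly true: the best deterministic
algorithms are exponential in the input length — `((p−1)/2)! mod p` in `p^{1/2+o(1)}` bit operations (Strassen;
BostanGaudrySchost2007), all Wilson quotients up to `N` in `N·polylog` only amortised (CostaGerbiczHarvey2014), or, through
the Chowla/Kiselev sign law `2·((p−1)/2)! ≡ ±t (mod p)`, the regulator and class number of `ℚ(√p)` (`p^{1/4+o(1)}`
deterministically, `L_p(1/2)` under GRH; JacobsonWilliams2008 §9.2, Ch. 12).  A CONSEQUENCE of the crux
(`notP_of_wilsonThesis`, by `P ⊆ BPP`), strictly weaker than it unless `BPP ⊆ P`.  Why it might fail: a deterministic polylog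
evaluation of the Wilson bit — e.g. Schoof's deterministic `√−1 mod p` plus any regulator-free formula for `ε_p mod p`, a
`p`-adic `Γ_p(1/2)` shortcut, or a quartic theta-reciprocity descent (route support `WilsonClassical`, lines (a)–(c)) — refutes
it directly (and the crux with it).  Hypothesis-type (it implies `P ≠ PSPACE`).
Leans on: `Computability.encodingNatBool` (BoolEncodings.lean), `Literature.Computability.Complexity.Classes.P`.
Sources: BostanGaudrySchost2007, CostaGerbiczHarvey2014, JacobsonWilliams2008, Chowla1961, Schoof1985, Tal2026ModularFactorials. -/
theorem stub_wilsonNotP :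
    Computability.encodingNatBool.toLanguage
        {p : ℕ | p.Prime ∧ p % 4 = 1 ∧ 2 * (Nat.factorial ((p - 1) / 2) % p) < p}
      ∉ Literature.Computability.Complexity.Classes.P := by
  sorry

/-! ## Sorry-free glue -/

/-- Read-back: the crux `WilsonThesis` is, by `Iff.rfl`, non-membership of the central-factorial language in `BPP`
(the conclusion of `compose` below). [folklore] -/
theorem wilsonThesis_iff :
    WilsonThesis ↔
      Computability.encodingNatBool.toLanguage
          {p : ℕ | p.Prime ∧ p % 4 = 1 ∧ 2 * (Nat.factorial ((p - 1) / 2) % p) < p}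
        ∉ Literature.Computability.Complexity.BPP :=
  Iff.rfl

/-- **Composition of the line** (the real glue, sorry-free; hypotheses = the two stub signatures verbatim; conclusion =
the right-hand side of `wilsonThesis_iff`).  Impagliazzo–Wigderson 1997, Thm 2 — PROVED in the tree as
`Literature.Computability.Complexity.impagliazzo_wigderson_holds` (worst-case → mild → strong average-case hardness inside `E`,
the quick Nisan–Wigderson generator, Yao's distinguisher-to-predictor lemma) — turns the circuit lower bound `hE` into
`P = BPP`; then a `BPP` decider for `L_W` would be a `P` decider, contradicting `hP`.
[cite: ImpagliazzoWigderson1997, Thm. 2] -/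
theorem compose
    (hE : ∃ L ∈ Literature.Computability.Complexity.E, ∃ ε : ℝ, 0 < ε ∧
      ∀ᶠ n : ℕ in Filter.atTop, (2 : ℝ) ^ (ε * n) ≤ (L.circuitSize n : ℝ))
    (hP : Computability.encodingNatBool.toLanguage
        {p : ℕ | p.Prime ∧ p % 4 = 1 ∧ 2 * (Nat.factorial ((p - 1) / 2) % p) < p}
      ∉ Literature.Computability.Complexity.Classes.P) :
    Computability.encodingNatBool.toLanguage
        {p : ℕ | p.Prime ∧ p % 4 = 1 ∧ 2 * (Nat.factorial ((p - 1) / 2) % p) < p}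
      ∉ Literature.Computability.Complexity.BPP := by
  -- Impagliazzo–Wigderson 1997, Thm. 2: hardness of `E` derandomises `BPP`.
  have hPB : Literature.Computability.Complexity.Classes.P = Literature.Computability.Complexity.BPP :=
    Literature.Computability.Complexity.impagliazzo_wigderson_holds hE
  rw [← hPB]
  exact hP

/-- **The skeleton theorem**: the crux `WilsonThesis` BY NAME from the two stubs (kernel-checked composition `compose`;
its only `sorry`s are inside `stub_eHardAE` and `stub_wilsonNotP`).  When both stubs land sorry-free this is the proof of
item stmt-QuantumAdvantage-10304. -/
theorem WilsonThesis_of : WilsonThesis :=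
  wilsonThesis_iff.2 (compose stub_eHardAE stub_wilsonNotP)

end Summit.QuantumAdvantage.QuantumAdvantage.Cruxes.WilsonThesis.Birth
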